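import Mathlib
import HarnessLib
import Summits.NavierStokesRegularity.NavierStokesRegularity.Theorems.ChiralWindowDoorClassDerivDecay
import Summits.NavierStokesRegularity.NavierStokesRegularity.Theorems.ChiralWindowDoorBinderFree
import Summits.NavierStokesRegularity.NavierStokesRegularity.Theorems.LocalSineTubeDoorProfileAlignedWindowRigidityAncient
import Summits.NavierStokesRegularity.NavierStokesRegularity.Theorems.PoloidalWindowDoorPoloidalWindowRigiditySymmetryGerms
import Summits.NavierStokesRegularity.NavierStokesRegularity.Theorems.SelfStrainDoorCubicBudget

/-!
# Door S22 «SelfStrainDoor» (nsreg-p1 ROUND-21; THEOREMS-ONLY landing) — file 4/5: THE RESIDUE K2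
# `selfStrainFreeProfileRigidity` — self-strain-free Type-I ancient mild profiles are not backward-singular

Texts and proofs of nsreg-p1 g18 `P1/r21/S22EndToEnd.lean` 9b9b0bcc57046adf (G2, F5, the spread and the compositions),
landed verbatim up to namespacing (lane `ns-pressure-K2-p1` g5, DIRECTOR-NS g9 #60 (1)); K2 is the decl the door consumes
BY NAME.

* `cubeToL3` (**G2**, pure measure theory) — a bound `∫ a φ₁(f) ≤ m` on the windowed regularised cubic energy gives
  `∫_{B₁} ‖f‖³ ≤ 3m` (`a = 1` on `B₁`, `‖f‖³ ≤ 3φ₁(f)`);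
* **F5** is the tree's `…ChiralWindowDoorBinderFree.essLocalClass_of_class` (nsreg-p6; ESS in the class, binder-free): a
  door-class profile with `sup_{t ∈ (−1,0)} ∫_{B₁}‖v(t)‖³ < ∞` is not backward-singular;
* `selfStrainFreeProfileRigidityEverywhere` — **THE RESIDUE, everywhere form**: a door-class profile with self-strain-free
  slices is not backward-singular (G1 `cubicBudget` on `[−2, 0)` ⇒ uniform windowed cubic energy ⇒ G2 ⇒ F5);
* `selfStrainSpread` — `σ(v s)` is real-analytic on door-class slices (`analyticOnNhd_slice`; `σ` is bilinear in
  `(v, Dv[v])`), so vanishing on a nonempty open set spreads to the slice;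
* `selfStrainFreeProfileRigidity` — **K2 (door crux, open-set form)**: a Type-I ancient mild profile (rate, space–time decay,
  continuity on the open slab, unit-viscosity Oseen–Duhamel identity, divergence-free slices) that is self-strain-free on a
  nonempty open set of every slice `s < 0` is not backward-singular at the apex.

WHAT THIS IS NOT: not NS regularity (Clay A), not a Type-I Liouville theorem (hard core 10661 untouched) — the residue of a
CONDITIONAL door: self-strain-freeness is the hypothesis (bears_on LADDER-NS N0, door S22).
-/

noncomputable section

-- the summit and its single sub-problem share the name (CONVENTIONS §1), as in every Theorems file
set_option linter.dupNamespace false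

namespace Summit.NavierStokesRegularity.NavierStokesRegularity.Theorems.SelfStrainDoorProfileRigidity

open MeasureTheory Set Function Filter Topology TopologicalSpace Metric InnerProductSpace
open scoped RealInnerProductSpace InnerProductSpace NNReal ENNReal
open Literature.Analysis Literature.Analysis.FluidPDE
open Summit.NavierStokesRegularity.NavierStokesRegularity.Theorems.ChiralWindowDoorDefs
open Summit.NavierStokesRegularity.NavierStokesRegularity.Theorems.ChiralWindowDoorClassDerivDecay
open Summit.NavierStokesRegularity.NavierStokesRegularity.Theorems.ChiralWindowDoorBinderFree (essLocalClass_of_class)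
open Summit.NavierStokesRegularity.NavierStokesRegularity.Theorems.LocalSineTubeDoorProfileAlignedWindowRigidityAncient
open Summit.NavierStokesRegularity.NavierStokesRegularity.Theorems.PoloidalWindowDoorPoloidalWindowRigiditySymmetryGerms
open Summit.NavierStokesRegularity.NavierStokesRegularity.Theorems.SelfStrainDoorDefs
open Summit.NavierStokesRegularity.NavierStokesRegularity.Theorems.ChiralWindowDoorLocalHelicityLower
  (contDiff_bumpSq continuous_bumpSq hasCompactSupport_bumpSq)
open Summit.NavierStokesRegularity.NavierStokesRegularity.Theorems.SelfStrainDoorCubicCalculus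
open Summit.NavierStokesRegularity.NavierStokesRegularity.Theorems.SelfStrainDoorCubicBudget

/-! ### G2: from the windowed cubic energy to `L³(B₁)` -/

/-- **G2 · FROM THE WEIGHTED CUBIC ENERGY TO `L³(B₁)`** (pure measure theory): `a = 1` on `B₁`, `‖f‖³ ≤ 3φ₁(f)`, and for
continuous `f` the weighted integrand is continuous with compact support, so the Bochner integral dominates the restricted
lower integral (`ofReal_integral_eq_lintegral_ofReal`). -/
theorem cubeToL3 : ∀ (η : EuclideanSpace ℝ (Fin 3) → ℝ), IsAdmissibleBump η →
    ∀ (f : EuclideanSpace ℝ (Fin 3) → EuclideanSpace ℝ (Fin 3)), Continuous f → ∀ m : ℝ,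
    ∫ x, bumpSq η 1 x * cubeReg (f x) ≤ m →
    ∫⁻ x in Metric.ball (0 : EuclideanSpace ℝ (Fin 3)) 1, ‖f x‖ₑ ^ (3 : ℕ) ≤ ENNReal.ofReal (3 * m) := by
  intro η hη f hf m hm
  set g : EuclideanSpace ℝ (Fin 3) → ℝ := fun x => 3 * (bumpSq η 1 x * cubeReg (f x)) with hg
  have hg_nonneg : ∀ x, 0 ≤ g x := fun x =>
    mul_nonneg (by norm_num) (mul_nonneg (bumpSq_nonneg η 1 x) (cubeReg_nonneg _))
  have hg_cont : Continuous g :=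
    continuous_const.mul ((continuous_bumpSq hη 1).mul (continuous_cubeReg.comp hf))
  have hg_supp : HasCompactSupport g := by
    refine HasCompactSupport.of_support_subset_isCompact (isCompact_closedBall (0 : EuclideanSpace ℝ (Fin 3)) 2) ?_
    intro x hx
    by_contra hx2
    rw [mem_closedBall_zero_iff, not_le] at hx2
    have h0 : bumpSq η 1 x = 0 := bumpSq_eq_zero hη one_pos (by linarith)
    exact hx (by simp [hg, h0])
  have hg_int : Integrable g := hg_cont.integrable_of_hasCompactSupport hg_supp
  have hpt : ∀ x ∈ Metric.ball (0 : EuclideanSpace ℝ (Fin 3)) 1, ‖f x‖ₑ ^ (3 : ℕ) ≤ ENNReal.ofReal (g x) := by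
    intro x hx
    rw [← ofReal_norm, ← ENNReal.ofReal_pow (norm_nonneg _)]
    apply ENNReal.ofReal_le_ofReal
    have h1 : bumpSq η 1 x = 1 := bumpSq_eq_one hη one_pos (le_of_lt (mem_ball_zero_iff.1 hx))
    simp only [hg, h1, one_mul]
    exact norm_pow_three_le_cubeReg (f x)
  calc ∫⁻ x in Metric.ball (0 : EuclideanSpace ℝ (Fin 3)) 1, ‖f x‖ₑ ^ (3 : ℕ)
      ≤ ∫⁻ x in Metric.ball (0 : EuclideanSpace ℝ (Fin 3)) 1, ENNReal.ofReal (g x) :=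
        setLIntegral_mono' measurableSet_ball hpt
    _ ≤ ∫⁻ x, ENNReal.ofReal (g x) := setLIntegral_le_lintegral _ _
    _ = ENNReal.ofReal (∫ x, g x) :=
        (ofReal_integral_eq_lintegral_ofReal hg_int (Eventually.of_forall hg_nonneg)).symm
    _ ≤ ENNReal.ofReal (3 * m) := by
        apply ENNReal.ofReal_le_ofReal
        have e : ∫ x, g x = 3 * ∫ x, bumpSq η 1 x * cubeReg (f x) := by
          simp only [hg]; exact integral_const_mul _ _
        rw [e]; linarith

/-! ### The residue, everywhere form: G1 + G2 + F5 -/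

/-- **THE RESIDUE (everywhere form).**  A door-class profile — Type-I rate, space–time Type-I decay, continuity on the open
slab, unit-viscosity Oseen–Duhamel identity, divergence-free slices — whose slices are SELF-STRAIN-FREE is not
backward-singular at the apex: the windowed cubic budget G1 (`cubicBudget`) from `t₁ = −2` bounds `∫ a φ₁(v(t))` uniformly on
`(−1, 0)`, G2 (`cubeToL3`) turns it into `sup_t ∫_{B₁}‖v(t)‖³ < ∞`, and F5 (`essLocalClass_of_class`) concludes. -/
theorem selfStrainFreeProfileRigidityEverywhere :
    ∀ (C D : ℝ) (v : ℝ → EuclideanSpace ℝ (Fin 3) → EuclideanSpace ℝ (Fin 3)),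
    Literature.Analysis.FluidPDE.HasTypeITimeDecay C v → Literature.Analysis.FluidPDE.HasTypeIDecay D v →
    ContinuousOn (Function.uncurry v) (Set.Iio (0 : ℝ) ×ˢ Set.univ) →
    (∀ s t : ℝ, s < t → t < 0 → ∀ x, v t x =
      Literature.Analysis.UnboundedOperators.heatExtension (v s) (t - s) x -
        Literature.Analysis.FluidPDE.oseenDuhamel 1 s v v t x) →
    (∀ t < 0, Literature.Analysis.FluidPDE.VectorCalculus.IsDivFree (v t)) →
    (∀ t < 0, IsSelfStrainFree (v t)) →
    ¬ Literature.Analysis.FluidPDE.IsBackwardSingularPoint v 0 := by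
  intro C D v hrate hdecay hcont hmild hdiv hss
  obtain ⟨η, hη⟩ := exists_admissibleBump
  obtain ⟨c, hc⟩ := cubicBudget η hη C D v hrate hdecay hcont hmild hdiv hss
  set m : ℝ := (∫ x, bumpSq η 1 x * cubeReg (v (-2) x)) + |c| * 2 with hm
  have hbound : ∀ t ∈ Set.Ioo (-1 : ℝ) 0, ∫ x, bumpSq η 1 x * cubeReg (v t x) ≤ m := by
    intro t ht
    have h := hc (-2) t (le_refl _) (by linarith [ht.1]) ht.2
    have h2 : c * (t - -2) ≤ |c| * 2 := by
      calc c * (t - -2) ≤ |c| * (t - -2) := mul_le_mul_of_nonneg_right (le_abs_self c) (by linarith [ht.1])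
        _ ≤ |c| * 2 := mul_le_mul_of_nonneg_left (by linarith [ht.2]) (abs_nonneg c)
    linarith
  have hL3 : ∃ M : NNReal, ∀ t ∈ Set.Ioo (-1 : ℝ) 0,
      ∫⁻ x in Metric.ball (0 : EuclideanSpace ℝ (Fin 3)) 1, ‖v t x‖ₑ ^ (3 : ℕ) ≤ M := by
    refine ⟨(3 * m).toNNReal, fun t ht => ?_⟩
    have h := cubeToL3 η hη (v t) (continuous_slice hcont ht.2) m (hbound t ht)
    exact h
  exact essLocalClass_of_class hrate hdecay hcont hmild hdiv hL3

/-! ### Spread from a window, and K2 -/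

/-- **SPREAD.**  `σ(v s)` is real-analytic on door-class slices (`analyticOnNhd_slice`: slices of Oseen-ancient fields are
real-analytic; `σ` is a bilinear expression in `(v, Dv[v])`), so its vanishing on a nonempty open set of every slice spreads
to the whole slice. -/
theorem selfStrainSpread : ∀ (C D : ℝ) (v : ℝ → EuclideanSpace ℝ (Fin 3) → EuclideanSpace ℝ (Fin 3)),
    HasTypeITimeDecay C v → HasTypeIDecay D v →
    ContinuousOn (Function.uncurry v) (Set.Iio (0 : ℝ) ×ˢ Set.univ) →
    (∀ s t : ℝ, s < t → t < 0 → ∀ x,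
        v t x = UnboundedOperators.heatExtension (v s) (t - s) x - oseenDuhamel 1 s v v t x) →
    (∀ t < 0, VectorCalculus.IsDivFree (v t)) →
    (∀ s < 0, ∃ U : Set (EuclideanSpace ℝ (Fin 3)), IsOpen U ∧ U.Nonempty ∧ ∀ z ∈ U, selfStrain (v s) z = 0) →
    ∀ t < 0, IsSelfStrainFree (v t) := by
  intro C D v hrate _hdecay hcont hmild _hdiv hwin t ht x
  obtain ⟨U, hU, hne, hUz⟩ := hwin t ht
  have hv : AnalyticOnNhd ℝ (v t) univ := analyticOnNhd_slice hcont (bdd_of_hasTypeITimeDecay hrate) hmild ht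
  have hDv : AnalyticOnNhd ℝ (fun y => fderiv ℝ (v t) y (v t y)) univ := analyticOnNhd_fderiv_apply hv hv
  have hσ : AnalyticOnNhd ℝ (selfStrain (v t)) univ := by
    intro y _
    have h := ((innerSL ℝ (E := EuclideanSpace ℝ (Fin 3))).analyticAt_bilinear (v t y, fderiv ℝ (v t) y (v t y))).comp₂
      (hv y (Set.mem_univ _)) (hDv y (Set.mem_univ _))
    exact h
  have h0 : AnalyticOnNhd ℝ (fun _ : EuclideanSpace ℝ (Fin 3) => (0 : ℝ)) univ := fun _ _ => analyticAt_const
  exact eq_of_eqOn_open hσ h0 hU hne hUz x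

/-- **K2 · `SelfStrainFreeProfileRigidity` (door S22's residue crux, open-set form) — PROVED.**  A Type-I ancient mild
profile — Type-I rate `C`, space–time Type-I decay `D`, continuous on the open backward slab, unit-viscosity Oseen–Duhamel
identity between negative times, divergence-free slices — that is SELF-STRAIN-FREE (`σ(v(s)) = ⟪v, Dv[v]⟫ = 0`) on a nonempty
open set of every slice `s < 0` is not backward-singular at the apex `(0,0)`.  (Spread to the slice by analyticity, then the
everywhere form: windowed cubic budget ⇒ `L³(B₁)` bound ⇒ ESS in the class.)  Text of nsreg-p1's route text
`SelfStrainFreeProfileRigidity` verbatim. -/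
theorem selfStrainFreeProfileRigidity :
    ∀ (C D : ℝ) (v : ℝ → EuclideanSpace ℝ (Fin 3) → EuclideanSpace ℝ (Fin 3)),
    Literature.Analysis.FluidPDE.HasTypeITimeDecay C v → Literature.Analysis.FluidPDE.HasTypeIDecay D v →
    ContinuousOn (Function.uncurry v) (Set.Iio (0 : ℝ) ×ˢ Set.univ) →
    (∀ s t : ℝ, s < t → t < 0 → ∀ x, v t x =
      Literature.Analysis.UnboundedOperators.heatExtension (v s) (t - s) x -
        Literature.Analysis.FluidPDE.oseenDuhamel 1 s v v t x) →
    (∀ t < 0, Literature.Analysis.FluidPDE.VectorCalculus.IsDivFree (v t)) →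
    (∀ s < 0, ∃ U : Set (EuclideanSpace ℝ (Fin 3)), IsOpen U ∧ U.Nonempty ∧ ∀ z ∈ U, selfStrain (v s) z = 0) →
    ¬ Literature.Analysis.FluidPDE.IsBackwardSingularPoint v 0 := by
  intro C D v hrate hdecay hcont hmild hdiv hwin
  exact selfStrainFreeProfileRigidityEverywhere C D v hrate hdecay hcont hmild hdiv
    (selfStrainSpread C D v hrate hdecay hcont hmild hdiv hwin)

end Summit.NavierStokesRegularity.NavierStokesRegularity.Theorems.SelfStrainDoorProfileRigidity

end
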